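import Summits.QuantumFields.YangMills.Theorems.UnitScaleTiltProp7HqVOfTraceBound
import Summits.QuantumFields.YangMills.Theorems.UnitScaleTiltProp7SectET3HilbertLettersT3
import Literature.MathematicalPhysics.QuantumFieldTheory.Balaban1983to89.B11Eq98V0primeCurrentSlots
import Literature.MathematicalPhysics.QuantumFieldTheory.Balaban1983to89.MatrixNorms
import HarnessLib

/-!
# Route `UnitScaleTilt`, crux «MinimiserStabilityRegPr» (stmt-QuantumFields-19200, stub EX `stub_existenceMinimalOrbit`), route (α) —
# **«RHO-NORM + TAU-NORM»: THE OPERATOR NORMS OF THE TWO FIBRE LETTERS OF RECORD, `ρ₂ := rieszτ frobEquiv` (`M_ρ = 1`) AND `τ₂ := tr` (`M_τ = 2`)**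

Cell `ym3-torus` (HUMAN RULING D-0037, YM ladder rung R3 — YM₃ on T³ is a rung, NOT d = 4, NOT a mass gap, NOT Clay; YM gap NOT proved), width seat `ym3-torus-px21` (gen 4).
THEOREMS ONLY (0 `def`, 0 `sorry`); `--supports stmt-QuantumFields-19200 --as helper`; count-neutral; NO claim on crux ∕ stub ∕ registry.  Pure `M₂(ℂ)` linear algebra
([folklore]; [Balaban1985Averaging] (18)–(20) p.21 is the dictionary: `‖X‖² = tr X*X` vs the operator norm `|X|`, `|X| ≤ √N‖X‖`), then two one-line instantiations of landed theorems.

WHY (EX namer ★w2-19200 g7 REVIEW PASS 2026-08-29T00:58:11Z: «`hMρ hMτ` are operator-norm facts about `rieszτ frobEquiv`∕`tr` … name the exact lemma + constant `Mρ`»).  ★px5 g3's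
PROP4-W80 door ✓`Prop7Prop4OfW80RowsAtRecord.prop4_W80_family` (p683940) displays the numerics `hMρ : ‖rieszτ frobEquiv‖ ≤ Mρ`, `hMτ : ‖tr‖ ≤ Mτ`, `hMρ0 : 0 ≤ Mρ`; ★px19 g4's
HQV-MTAU ✓`Prop7HqVOfTraceBound.hqV_bgOfCfg_of_regPr_trace_family` (p683712) keeps the residual row `hρ : ∀ ℓ, ‖ρ₂ ℓ‖ ≤ Mρ‖ℓ‖`.  THIS FILE discharges all three at the letters of
record with the NUMERALS `Mρ := 1`, `Mτ := 2`.

THE ARGUMENT.  `W₂ = ℂ^{2×2}` carries the Frobenius (`L²`) norm and `frobEquiv : W₂ ≃ₗ[ℂ] M₂(ℂ)` reads a vector as a matrix in the `L²`-OPERATOR norm; row-wise Cauchy–Schwarz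
(lit ✓`MatrixNorms.opNorm_sq_le_sum_norm_sq`) gives `‖frobEquiv v‖ ≤ ‖v‖`, and the column bound (lit ✓`MatrixNorms.sum_norm_sq_col_le_opNorm_sq`) gives `‖frobEquiv⁻¹ X‖ ≤ √2‖X‖`.
lit's dualising map is `rieszτ frobEquiv ℓ = (frobEquiv v)⋆` with `v` the Riesz vector of `ℓ ∘ frobEquiv` (✓`rieszτ_apply`), so
`‖ρ₂ ℓ‖ = ‖frobEquiv v‖ ≤ ‖v‖ = ‖ℓ ∘ frobEquiv‖ ≤ ‖ℓ‖·‖frobEquiv‖ ≤ ‖ℓ‖` (C⋆-norm of `⋆`, Riesz isometry, `opNorm_comp_le`).  `‖tr X‖ ≤ 2‖X‖` is ✓`norm_trace_clm_le` (px19).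

WHAT IS PROVED (ns `…Theorems.Prop7RieszTauFrobNorm`).
* §1 `norm_sq_frobEquiv_symm` (`‖frobEquiv⁻¹ X‖² = Σᵢⱼ ‖X i j‖²`), `norm_le_norm_frobEquiv_symm` (`‖X‖ ≤ ‖frobEquiv⁻¹ X‖`), ★`norm_frobEquiv_le` (`‖frobEquiv v‖ ≤ ‖v‖`),
  `sum_norm_sq_le_two_mul_opNorm_sq`, `norm_frobEquiv_symm_le` (`‖frobEquiv⁻¹ X‖ ≤ √2‖X‖`), `norm_le_sqrt_two_mul_norm_frobEquiv`, ★`opNorm_frobEquivL_le_one`.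
* §2 ★★`norm_rieszτ_frobEquiv_le` (`‖rieszτ frobEquiv ℓ‖ ≤ ‖ℓ‖`), ★★`hρ_rieszτ_frobEquiv_one` (p683712's `hρ` at `Mρ := 1`), ★★`opNorm_rieszτ_frobEquiv_le_one` (p683940's `hMρ` at `Mρ := 1`).
* §3 ★`opNorm_trace_clm_le_two` (p683940's `hMτ` at `Mτ := 2`), `norm_trace_clm_one` (`‖tr 1‖ = 2`: the constant `2` is attained).
* §4 ★★`hqV_record_family` — ✓`hqV_bgOfCfg_of_regPr_trace_family` at `ρ₂ := rieszτ frobEquiv`, `Mρ := 1`: the PROP4-W80 door's `hqV` row at the letters of record with NO residual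
  hypothesis, `C_V L := 2·(1024·2·1·(α L + 1∕16) + 2·138·1)`.
* §5 (v1.1) ★★`hqV_record_family_at` — the same in S15ᴰ's EXACT binder prefix (`RegPr (α L) U₀ →`; ✓p684527 :125–127 VERBATIM).
HONEST SCOPE: numerals for displayed numeric rows; nothing of [Balaban1985Variational] is asserted; nothing of the stub ∕ crux claimed.
References: T. Bałaban, CMP 98 (1985) 17–51 [Balaban1985Averaging] ((17)–(20) pp.20–21); CMP 102 (1985) 277–309 [Balaban1985Variational] ((27) p.282, (90)–(98) pp.291–293).
-/

set_option autoImplicit false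

noncomputable section

open scoped Matrix.Norms.L2Operator BigOperators ComplexConjugate InnerProductSpace

namespace Summit.QuantumFields.YangMills.Theorems.Prop7RieszTauFrobNorm

open Literature.MathematicalPhysics.QuantumFieldTheory.Balaban1983to89
open Literature.MathematicalPhysics.QuantumFieldTheory.Balaban1983to89.T3ContinuumYM3Torus
open Literature.MathematicalPhysics.QuantumFieldTheory.Balaban1983to89.T3Thm1Carrier (Idx)
open Literature.MathematicalPhysics.QuantumFieldTheory.Balaban1983to89.T3PrintedRegularMinimiser (RegPr)
open Literature.MathematicalPhysics.QuantumFieldTheory.Balaban1983to89.B11Eq98V0primeCurrentSlots (rieszτ rieszτ_apply)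
open Literature.MathematicalPhysics.QuantumFieldTheory.Balaban1983to89.B11Eq63V0GroupCurrent (curV0)
open B9SectCLatticeCarrier (Bond)
open B11Eq115Space (Space115)
open B11Eq111FrakG (nabla115)
open Summit.QuantumFields.YangMills.Theorems.Prop7SectET3Transport (periodsT3 bgOfCfg)
open Summit.QuantumFields.YangMills.Theorems.Prop7SectET3HilbertLetters (W₂ frobEquiv frobEquiv_symm_apply_apply)
open Summit.QuantumFields.YangMills.Theorems.Prop7HqVOfTraceBound (norm_trace_clm_le hqV_bgOfCfg_of_regPr_trace_family)

/-! ## §1 The two normings of the fibre: `W₂` (Frobenius) vs `M₂(ℂ)` (`L²`-operator norm) along `frobEquiv` -/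

/-- `‖frobEquiv⁻¹ X‖² = Σᵢ Σⱼ ‖X i j‖²` — the Frobenius norm written in the matrix's entries ([Balaban1985Averaging] p.21 «`‖X‖² = tr X*X`», un-normalised here).
[cite: Balaban1985Averaging, (18) p.21] -/
theorem norm_sq_frobEquiv_symm (X : Matrix (Fin 2) (Fin 2) ℂ) :
    ‖(frobEquiv.symm X : W₂)‖ ^ 2 = ∑ i, ∑ j, ‖X i j‖ ^ 2 := by
  rw [EuclideanSpace.norm_sq_eq, Fintype.sum_prod_type]
  simp only [frobEquiv_symm_apply_apply]

/-- `|X| ≤ ‖frobEquiv⁻¹ X‖`: the `L²`-operator norm is bounded by the (un-normalised) Frobenius norm ([Balaban1985Averaging] (20); lit ✓`MatrixNorms.opNorm_sq_le_sum_norm_sq`).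
[cite: Balaban1985Averaging, (20) p.21] -/
theorem norm_le_norm_frobEquiv_symm (X : Matrix (Fin 2) (Fin 2) ℂ) : ‖X‖ ≤ ‖(frobEquiv.symm X : W₂)‖ := by
  have h : ‖X‖ ^ 2 ≤ ‖(frobEquiv.symm X : W₂)‖ ^ 2 := by
    rw [norm_sq_frobEquiv_symm]
    exact MatrixNorms.opNorm_sq_le_sum_norm_sq X
  exact (pow_le_pow_iff_left₀ (norm_nonneg _) (norm_nonneg _) two_ne_zero).mp h

/-- ★ `|frobEquiv v| ≤ ‖v‖`: reading a Frobenius vector as a matrix does not increase the norm. [cite: Balaban1985Averaging, (20) p.21] -/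
theorem norm_frobEquiv_le (v : W₂) : ‖frobEquiv v‖ ≤ ‖v‖ := by
  have h := norm_le_norm_frobEquiv_symm (frobEquiv v)
  rwa [LinearEquiv.symm_apply_apply] at h

/-- `Σᵢⱼ ‖X i j‖² ≤ 2|X|²` on `M₂(ℂ)` (each of the two columns is bounded by `|X|`; lit ✓`MatrixNorms.sum_norm_sq_col_le_opNorm_sq`). [cite: Balaban1985Averaging, (20) p.21] -/
theorem sum_norm_sq_le_two_mul_opNorm_sq (X : Matrix (Fin 2) (Fin 2) ℂ) : ∑ i, ∑ j, ‖X i j‖ ^ 2 ≤ 2 * ‖X‖ ^ 2 := by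
  rw [Finset.sum_comm]
  calc ∑ j, ∑ i, ‖X i j‖ ^ 2 ≤ ∑ _j : Fin 2, ‖X‖ ^ 2 := Finset.sum_le_sum fun j _ => MatrixNorms.sum_norm_sq_col_le_opNorm_sq X j
    _ = 2 * ‖X‖ ^ 2 := by simp [two_mul]

/-- `‖frobEquiv⁻¹ X‖ ≤ √2·|X|` — [Balaban1985Averaging] (20)'s third inequality `|X| ≤ √N‖X‖` read the other way for the UN-normalised Frobenius norm (`N = 2`).
[cite: Balaban1985Averaging, (20) p.21] -/
theorem norm_frobEquiv_symm_le (X : Matrix (Fin 2) (Fin 2) ℂ) : ‖(frobEquiv.symm X : W₂)‖ ≤ Real.sqrt 2 * ‖X‖ := by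
  have h : ‖(frobEquiv.symm X : W₂)‖ ^ 2 ≤ (Real.sqrt 2 * ‖X‖) ^ 2 := by
    rw [norm_sq_frobEquiv_symm, mul_pow, Real.sq_sqrt (by norm_num : (0 : ℝ) ≤ 2)]
    exact sum_norm_sq_le_two_mul_opNorm_sq X
  exact (pow_le_pow_iff_left₀ (norm_nonneg _) (by positivity) two_ne_zero).mp h

/-- `‖v‖ ≤ √2·|frobEquiv v|`. [cite: Balaban1985Averaging, (20) p.21] -/
theorem norm_le_sqrt_two_mul_norm_frobEquiv (v : W₂) : ‖v‖ ≤ Real.sqrt 2 * ‖frobEquiv v‖ := by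
  have h := norm_frobEquiv_symm_le (frobEquiv v)
  rwa [LinearEquiv.symm_apply_apply] at h

/-- ★ The identification `frobEquiv`, as a continuous linear map `W₂ →L[ℂ] M₂(ℂ)`, has operator norm `≤ 1`. [cite: Balaban1985Averaging, (20) p.21] -/
theorem opNorm_frobEquivL_le_one :
    ‖(LinearMap.toContinuousLinearMap (frobEquiv.toLinearMap) : W₂ →L[ℂ] Matrix (Fin 2) (Fin 2) ℂ)‖ ≤ 1 :=
  ContinuousLinearMap.opNorm_le_bound _ zero_le_one fun v => by
    simpa only [LinearMap.coe_toContinuousLinearMap', LinearEquiv.coe_coe, one_mul] using norm_frobEquiv_le v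

/-! ## §2 ★★ The fibre letter of record `ρ₂ := rieszτ frobEquiv`: `M_ρ = 1` -/

/-- ★★ **`‖rieszτ frobEquiv ℓ‖ ≤ ‖ℓ‖`**: lit's dualising map of the bilinear trace pairing (27) at the cell's Hilbert fibre is a contraction from the dual of `(M₂(ℂ), |·|)` to
`(M₂(ℂ), |·|)` — `ρ₂ ℓ = (frobEquiv v)⋆`, `v` the Riesz vector of `ℓ ∘ frobEquiv`; `|Y⋆| = |Y|`, `|frobEquiv v| ≤ ‖v‖ = ‖ℓ ∘ frobEquiv‖ ≤ ‖ℓ‖`.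
[cite: Balaban1985Variational, (27) p.282; Balaban1985Averaging, (18)-(20) p.21] -/
theorem norm_rieszτ_frobEquiv_le (ℓ : Matrix (Fin 2) (Fin 2) ℂ →L[ℂ] ℂ) : ‖rieszτ frobEquiv ℓ‖ ≤ ‖ℓ‖ := by
  rw [rieszτ_apply, norm_star]
  refine (norm_frobEquiv_le _).trans ?_
  rw [LinearIsometryEquiv.norm_map]
  refine (ContinuousLinearMap.opNorm_comp_le _ _).trans ?_
  calc ‖ℓ‖ * ‖(LinearMap.toContinuousLinearMap (frobEquiv.toLinearMap) : W₂ →L[ℂ] Matrix (Fin 2) (Fin 2) ℂ)‖ ≤ ‖ℓ‖ * 1 :=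
        mul_le_mul_of_nonneg_left opNorm_frobEquivL_le_one (norm_nonneg ℓ)
    _ = ‖ℓ‖ := mul_one _

/-- ★★ **THE RESIDUAL ROW `hρ` OF ✓`hqV_bgOfCfg_of_regPr_trace_family` (p683712) AT THE LETTER OF RECORD, `Mρ := 1`**: `∀ ℓ, ‖rieszτ frobEquiv ℓ‖ ≤ 1·‖ℓ‖`.
[cite: Balaban1985Variational, (27) p.282; Balaban1985Averaging, (18)-(20) p.21] -/
theorem hρ_rieszτ_frobEquiv_one : ∀ ℓ : Matrix (Fin 2) (Fin 2) ℂ →L[ℂ] ℂ, ‖rieszτ frobEquiv ℓ‖ ≤ 1 * ‖ℓ‖ :=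
  fun ℓ => (norm_rieszτ_frobEquiv_le ℓ).trans_eq (one_mul _).symm

/-- ★★ **THE NUMERIC ROW `hMρ` OF ✓`prop4_W80_family` (p683940) AT `Mρ := 1`**: the operator norm of `rieszτ frobEquiv : (M₂(ℂ) →L[ℂ] ℂ) →L[ℂ] M₂(ℂ)` is `≤ 1` (binder text VERBATIM).
[cite: Balaban1985Variational, (27) p.282; Balaban1985Averaging, (18)-(20) p.21] -/
theorem opNorm_rieszτ_frobEquiv_le_one :
    ‖((rieszτ frobEquiv) : (Matrix (Fin 2) (Fin 2) ℂ →L[ℂ] ℂ) →L[ℂ] Matrix (Fin 2) (Fin 2) ℂ)‖ ≤ 1 :=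
  ContinuousLinearMap.opNorm_le_bound _ zero_le_one hρ_rieszτ_frobEquiv_one

/-! ## §3 ★ The trace letter of record `τ₂ := tr`: `M_τ = 2` -/

/-- ★ **THE NUMERIC ROW `hMτ` OF ✓`prop4_W80_family` (p683940) AT `Mτ := 2`**: the operator norm of the UN-normalised trace `tr : (M₂(ℂ), |·|) → ℂ` is `≤ 2` (binder text VERBATIM;
✓`norm_trace_clm_le`, i.e. [Balaban1985Averaging] (20) `|tr X| ≤ |X|` for the NORMALISED trace). [cite: Balaban1985Averaging, (17) p.20, (20) p.21] -/
theorem opNorm_trace_clm_le_two :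
    ‖((LinearMap.toContinuousLinearMap (Matrix.traceLinearMap (Fin 2) ℂ ℂ)) : Matrix (Fin 2) (Fin 2) ℂ →L[ℂ] ℂ)‖ ≤ 2 :=
  ContinuousLinearMap.opNorm_le_bound _ zero_le_two norm_trace_clm_le

/-- `‖tr 1‖ = 2` (and `|1| = 1`): the constant `Mτ = 2` is attained — the un-normalised trace is NOT contractive in the `L²`-operator norm (★px5 g3's SNAG 2).
[cite: Balaban1985Averaging, (17) p.20] -/
theorem norm_trace_clm_one :
    ‖LinearMap.toContinuousLinearMap (Matrix.traceLinearMap (Fin 2) ℂ ℂ) (1 : Matrix (Fin 2) (Fin 2) ℂ)‖ = 2 := by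
  simp only [LinearMap.coe_toContinuousLinearMap', Matrix.traceLinearMap_apply, Matrix.trace_one, Fintype.card_fin]
  simp

/-! ## §4 ★★ The `hqV` row of the PROP4-W80 door at BOTH letters of record — no residual hypothesis -/

variable [hFL : ∀ F : T3Family, Fact (0 < (F.L : ℝ))] [hFη : ∀ (F : T3Family) (k : ℕ), Fact (0 < ((F.L : ℝ)⁻¹) ^ k)]

/-- ★★ **`hqV` AT THE LETTERS OF RECORD `(ρ₂, τ₂) := (rieszτ frobEquiv, tr)`, FAMILY SHAPE, CLOSED**: for every member `(L, i, U₀)` with `RegPr ρ U₀`, `ρ ≤ α L` (`0 < α L`), and every `Y`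
in the `1∕16`-ball of the member's (115)-space, `‖curV0 (rieszτ frobEquiv) tr (bgOfCfg U₀) Y‖ ≤ C_V L·‖Y‖²` with `C_V L := 2·(1024·2·1·(α L + 1∕16) + 2·138·1)` — ✓p683712's
`hqV_bgOfCfg_of_regPr_trace_family` with its residual `hρ` DISCHARGED by §2 (`Mρ := 1`).
[cite: Balaban1985Variational, (90)–(96) pp.291–292, Prop. 4 (98) p.293; Balaban1985BackgroundPropagators, (3.35) p.396] -/
theorem hqV_record_family {α : ℕ → ℝ} (hα : ∀ L, 1 < L → 0 < α L) :
    ∀ (L : ℕ), 1 < L → ∀ (i : Idx L) (ρ : ℝ) (U₀ : GaugeField (i.1.1.P i.1.2.2) 0 (Matrix.specialUnitaryGroup (Fin 2) ℂ)),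
      RegPr i.1.1 i.1.2.1 i.1.2.2 ρ U₀ → ρ ≤ α L →
      ∀ Y : Space115 (i.1.1.L : ℝ) (((i.1.1.L : ℝ)⁻¹) ^ (i.1.2.2 - i.1.2.1)) (fun _ : Bond 3 (periodsT3 i.1.1 i.1.2.2) => i.1.2.2 - i.1.2.1)
          (fun _ : Bond 3 (periodsT3 i.1.1 i.1.2.2) × Fin 3 => i.1.2.2 - i.1.2.1) (nabla115 (((i.1.1.L : ℝ)⁻¹) ^ (i.1.2.2 - i.1.2.1)) (bgOfCfg i.1.1 i.1.2.2 U₀)),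
        ‖Y‖ < 1 / 16 →
        ‖curV0 (lev₁ := fun _ : Bond 3 (periodsT3 i.1.1 i.1.2.2) × Fin 3 => i.1.2.2 - i.1.2.1) (Dc := nabla115 (((i.1.1.L : ℝ)⁻¹) ^ (i.1.2.2 - i.1.2.1)) (bgOfCfg i.1.1 i.1.2.2 U₀)) (rieszτ frobEquiv)
            (LinearMap.toContinuousLinearMap (Matrix.traceLinearMap (Fin 2) ℂ ℂ)) (bgOfCfg i.1.1 i.1.2.2 U₀) Y‖ ≤
          2 * (1024 * ((3 - 1 : ℕ) : ℝ) * 1 * (α L + 1 / 16) + ((3 - 1 : ℕ) : ℝ) * 138 * 1) * ‖Y‖ ^ 2 :=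
  hqV_bgOfCfg_of_regPr_trace_family hα (rieszτ frobEquiv) zero_le_one hρ_rieszτ_frobEquiv_one

/-! ## §5 (v1.1) The `hqV` row in S15ᴰ's EXACT binder prefix (`RegPr (α L) U₀ →`, no `ρ ≤ α L` step) -/

/-- ★★ **S15ᴰ's `hqV` BINDER TEXT VERBATIM** (✓p684527 :125–127, prefix `∀ L>1 i U₀, RegPr (α L) U₀ → ∀ Y, ‖Y‖ < 1∕16 →`) at the letters of record, with
`CV L := 2 * (1024 * ((3 - 1 : ℕ) : ℝ) * 1 * (α L + 1 / 16) + ((3 - 1 : ℕ) : ℝ) * 138 * 1)` — `hqV_record_family` at `ρ := α L`.  S16 feeds `hqV := hqV_record_family_at hα`.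
[cite: Balaban1985Variational, (90)–(96) pp.291–292, Prop. 4 (98) p.293; Balaban1985BackgroundPropagators, (3.35) p.396] -/
theorem hqV_record_family_at {α : ℕ → ℝ} (hα : ∀ L, 1 < L → 0 < α L) :
    ∀ (L : ℕ), 1 < L → ∀ (i : Idx L) (U₀ : GaugeField (i.1.1.P i.1.2.2) 0 (Matrix.specialUnitaryGroup (Fin 2) ℂ)), RegPr i.1.1 i.1.2.1 i.1.2.2 (α L) U₀ →
      ∀ Y : Space115 (i.1.1.L : ℝ) (((i.1.1.L : ℝ)⁻¹) ^ (i.1.2.2 - i.1.2.1)) (fun _ : Bond 3 (periodsT3 i.1.1 i.1.2.2) => i.1.2.2 - i.1.2.1)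
          (fun _ : Bond 3 (periodsT3 i.1.1 i.1.2.2) × Fin 3 => i.1.2.2 - i.1.2.1) (nabla115 (((i.1.1.L : ℝ)⁻¹) ^ (i.1.2.2 - i.1.2.1)) (bgOfCfg i.1.1 i.1.2.2 U₀)), ‖Y‖ < 1 / 16 → ‖curV0 (lev₁ := fun _ : Bond 3 (periodsT3 i.1.1 i.1.2.2) × Fin 3 => i.1.2.2 - i.1.2.1) (Dc := nabla115 (((i.1.1.L : ℝ)⁻¹) ^ (i.1.2.2 - i.1.2.1)) (bgOfCfg i.1.1 i.1.2.2 U₀)) (rieszτ frobEquiv) (LinearMap.toContinuousLinearMap (Matrix.traceLinearMap (Fin 2) ℂ ℂ)) (bgOfCfg i.1.1 i.1.2.2 U₀) Y‖ ≤ 2 * (1024 * ((3 - 1 : ℕ) : ℝ) * 1 * (α L + 1 / 16) + ((3 - 1 : ℕ) : ℝ) * 138 * 1) * ‖Y‖ ^ 2 :=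
  fun L hL i U₀ hreg Y hY => hqV_record_family hα L hL i (α L) U₀ hreg le_rfl Y hY

end Summit.QuantumFields.YangMills.Theorems.Prop7RieszTauFrobNorm

end
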